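import Summits.QuantumAdvantage.QuantumAdvantage.Theorems.CubicForrelationNearExactIsExactCubicFormFibreAffine
import Summits.QuantumAdvantage.QuantumAdvantage.Theorems.CubicForrelationNearExactIsExactCubicFormBalanced
import Summits.QuantumAdvantage.QuantumAdvantage.Theorems.CubicForrelationNearExactIsExactCubicFormDicksonExact
import Summits.QuantumAdvantage.QuantumAdvantage.Theorems.CubicForrelationNearExactIsExactCubicFormSymplectic

/-!
# Crux `CubicForrelation.NearExactIsExact` (stmt-QuantumAdvantage-14043) — the `h = 1` MENU of a `T`-cell: `wt ≥ 160`, and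
  `wt < 192 ⇒` type `(1,0)` (every fibre quadratic is constant on the radical of `β_FF`)

Certificate seat `b2b-cforr-cert` (gen 41).  HONEST FRAMING: kernel-checked counting (standard axioms), the `h = 1` paragraph of cell lemma
L-T (HOME/b2b-cforr-cert-g39/E1280-HANDPROOFS.md App. A.3).  For `f = y₀y₁y₂ ⊕ Q` on `3 + 6` bits whose fibre quadratics
`Q_t = Q(t, ·)` all have the symplectic form `B` of rank `2` (a maximal frame of size `h = 1`): every fibre weighs `16`, `32` or `48`
(…CubicFormDicksonExact), and weighs `32` iff `Q_t` is non-constant on `Rad B` (…CubicFormBalanced); the fibres constant on the radical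
form an affinely closed set `Z′` (the linear parts add: `ℓ_{t⊕a⊕a′} = ℓ_t ⊕ ℓ_a ⊕ ℓ_{a′}`), so `#Z′ ∈ {8} ∪ [0, 4]` (…CubicFormFibreAffine).
With the fibre formula (…CubicFormFibre): `#Z′ ≤ 4 ⇒ wt f ≥ 192`; `Z′ = 𝔽₂³ ⇒ wt f ∈ 128 + 32ℕ` and `wt f = 128` would make the `9`-bit
quadratic `Q` take the value `1` exactly `160 = 256 − 96` times, impossible by Dickson on `9` bits (…CubicFormSymplectic frame +
…CubicFormDicksonExact).  Hence `M(1, ·) ≥ 160` and a cell of weight `< 192` with `h = 1` has all fibres constant on `Rad B` — type `(1,0)`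
("rows of `β_UF` in `span(l₁, l₂)`").  Nothing about `θ₁₂`; NOT summit progress.

* `tfh_T_menu_h1`: the two conclusions, in the interface of `tfm_T_menu` (…CubicFormFibreMenu) plus `h = 1`.

References: E1280-HANDPROOFS.md App. A.3; L. E. Dickson (1901).  Axioms: the standard three.
-/

set_option linter.dupNamespace false -- D-0017: single-problem summit ⇒ `QuantumAdvantage.QuantumAdvantage` by design

namespace Summit.QuantumAdvantage.QuantumAdvantage.Theorems.CubicForrelation.NearExactIsExact

open Finset
open Literature.Computability.QuantumComplexity.BuzetChailloux (bxor zeroVec allOnes bxor_comm bxor_self bxor_zeroVec zeroVec_bxor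
  bxor_bxor_cancel_left)

/-- **The `h = 1` menu of a `T`-cell.**  See the module docstring: `160 ≤ wt f`, and `wt f < 192 ⇒` every fibre quadratic is constant
on the radical of `B`. [this work; E1280-HANDPROOFS App. A.3] -/
theorem tfh_T_menu_h1 (f : (Fin (3 + 6) → Bool) → Bool)
    (hT : ∀ u v w x : Fin (3 + 6) → Bool,
      (((f x ^^ f (bxor x w)) ^^ (f (bxor x v) ^^ f (bxor (bxor x v) w))) ^^
          ((f (bxor x u) ^^ f (bxor (bxor x u) w)) ^^ (f (bxor (bxor x u) v) ^^ f (bxor (bxor (bxor x u) v) w)))) =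
        ((((u (Fin.castAdd 6 0) && (v (Fin.castAdd 6 1) && w (Fin.castAdd 6 2))) ^^
              (u (Fin.castAdd 6 0) && (v (Fin.castAdd 6 2) && w (Fin.castAdd 6 1)))) ^^
            ((u (Fin.castAdd 6 1) && (v (Fin.castAdd 6 0) && w (Fin.castAdd 6 2))) ^^
              (u (Fin.castAdd 6 1) && (v (Fin.castAdd 6 2) && w (Fin.castAdd 6 0))))) ^^
          ((u (Fin.castAdd 6 2) && (v (Fin.castAdd 6 0) && w (Fin.castAdd 6 1))) ^^
            (u (Fin.castAdd 6 2) && (v (Fin.castAdd 6 1) && w (Fin.castAdd 6 0))))))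
    (B : (Fin 6 → Bool) → (Fin 6 → Bool) → Bool)
    (hB : ∀ (t : Fin 3 → Bool) (v w x : Fin 6 → Bool),
      let Qt : (Fin 6 → Bool) → Bool := fun s =>
        f (Fin.append t s) ^^ (((Fin.append t s) (Fin.castAdd 6 0) && (Fin.append t s) (Fin.castAdd 6 1)) && (Fin.append t s) (Fin.castAdd 6 2))
      ((Qt x ^^ Qt (bxor x w)) ^^ (Qt (bxor x v) ^^ Qt (bxor (bxor x v) w))) = B v w)
    (h : ℕ) (b c : Fin h → (Fin 6 → Bool))
    (hbc : ∀ i, B (b i) (c i) = true) (hbc' : ∀ i j, i ≠ j → B (b i) (c j) = false) (hbb : ∀ i j, B (b i) (b j) = false)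
    (hmax : ∀ x y, (∀ i, B x (b i) = false) → (∀ i, B x (c i) = false) → (∀ i, B y (b i) = false) → (∀ i, B y (c i) = false) →
      B x y = false) (hh : h = 1) :
    let Qf : (Fin 3 → Bool) → (Fin 6 → Bool) → Bool := fun t s =>
      f (Fin.append t s) ^^ (((Fin.append t s) (Fin.castAdd 6 0) && (Fin.append t s) (Fin.castAdd 6 1)) && (Fin.append t s) (Fin.castAdd 6 2))
    160 ≤ #(univ.filter fun y : Fin (3 + 6) → Bool => f y = true) ∧
    (#(univ.filter fun y : Fin (3 + 6) → Bool => f y = true) < 192 →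
      ∀ (t : Fin 3 → Bool) (r : Fin 6 → Bool), (∀ y, B r y = false) → Qf t r = Qf t zeroVec) := by
  classical
  intro Qf
  subst hh
  obtain ⟨h3, hfib⟩ := tfb_fibre_formula f hT
  set Q : (Fin (3 + 6) → Bool) → Bool := fun z => f z ^^ ((z (Fin.castAdd 6 0) && z (Fin.castAdd 6 1)) && z (Fin.castAdd 6 2)) with hQ
  -- fibre weights, as an opaque function with defining equations
  obtain ⟨w, hw⟩ : ∃ w : (Fin 3 → Bool) → ℕ, ∀ v, w v = #(univ.filter fun s : Fin 6 → Bool => Q (Fin.append v s) = true) :=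
    ⟨_, fun _ => rfl⟩
  have hfib' : #(univ.filter fun y : Fin (3 + 6) → Bool => f y = true) + w allOnes =
      (∑ v ∈ (univ : Finset (Fin 3 → Bool)).erase allOnes, w v) + 2 ^ 6 := by
    rw [hw, sum_congr rfl fun v _ => hw v]; exact hfib
  have hcard7 : #((univ : Finset (Fin 3 → Bool)).erase allOnes) = 7 := by
    rw [card_erase_of_mem (mem_univ _), card_univ, Fintype.card_fun, Fintype.card_bool, Fintype.card_fin]; rfl
  have hBQ : ∀ (t : Fin 3 → Bool) (v w' x : Fin 6 → Bool), ((Q (Fin.append t x) ^^ Q (Fin.append t (bxor x w'))) ^^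
      (Q (Fin.append t (bxor x v)) ^^ Q (Fin.append t (bxor (bxor x v) w')))) = B v w' := fun t v w' x => hB t v w' x
  -- Dickson per fibre (`h = 1`): weights `16 / 32 / 48`
  have hD : ∀ t, w t = 16 ∨ w t = 32 ∨ w t = 48 := by
    intro t
    have hd : 1 ≤ 6 ∧ (2 * w t + 2 ^ (6 - 1) = 2 ^ 6 ∨ 2 * w t = 2 ^ 6 ∨ 2 * w t = 2 ^ 6 + 2 ^ (6 - 1)) := by
      rw [hw]; exact tce_dickson_exact (fun s => Q (Fin.append t s)) B (hBQ t) 1 b c hbc hbc' hbb hmax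
    norm_num at hd
    omega
  -- balanced iff non-constant on the radical, per fibre
  have hbal : ∀ t, 2 * w t = 64 ↔ ∃ r, (∀ y, B r y = false) ∧ Q (Fin.append t r) ≠ Q (Fin.append t zeroVec) := by
    intro t
    have e := tcb_balanced_iff (fun s => Q (Fin.append t s)) B (hBQ t)
    rw [← hw] at e
    norm_num at e
    exact e
  -- additivity of the linear parts: `ℓ_{t ⊕ a} = ℓ_t ⊕ ℓ_a ⊕ ℓ_0`
  have hℓ : ∀ (t a : Fin 3 → Bool) (s : Fin 6 → Bool), (Q (Fin.append (bxor t a) s) ^^ Q (Fin.append (bxor t a) zeroVec)) =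
      ((Q (Fin.append t s) ^^ Q (Fin.append t zeroVec)) ^^ (Q (Fin.append a s) ^^ Q (Fin.append a zeroVec)) ^^
        (Q (Fin.append zeroVec s) ^^ Q (Fin.append zeroVec zeroVec))) := by
    intro t a s
    have e := hT (Fin.append t zeroVec) (Fin.append a zeroVec) (Fin.append zeroVec s)
      (Fin.append (zeroVec : Fin 3 → Bool) (zeroVec : Fin 6 → Bool))
    have hz3 : ∀ k, (zeroVec : Fin 3 → Bool) k = false := fun k => rfl
    simp only [tcc_append_bxor, bxor_zeroVec, zeroVec_bxor, Fin.append_left, hz3, Bool.and_false, Bool.xor_false] at e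
    simp only [hQ, Fin.append_left]
    revert e
    generalize f (Fin.append (bxor t a) s) = A₁
    generalize f (Fin.append (bxor t a) zeroVec) = A₂
    generalize f (Fin.append t s) = A₃
    generalize f (Fin.append t zeroVec) = A₄
    generalize f (Fin.append a s) = A₅
    generalize f (Fin.append a zeroVec) = A₆
    generalize f (Fin.append zeroVec s) = A₇
    generalize f (Fin.append zeroVec zeroVec) = A₈
    generalize ((bxor t a 0 && bxor t a 1) && bxor t a 2) = M₁
    generalize ((t 0 && t 1) && t 2) = M₂
    generalize ((a 0 && a 1) && a 2) = M₃
    simp only [hz3, Bool.false_and, Bool.xor_false]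
    revert A₁ A₂ A₃ A₄ A₅ A₆ A₇ A₈ M₁ M₂ M₃
    decide
  -- `Z'`: the fibres constant on the radical; it is affinely closed
  set Z' := univ.filter fun t : Fin 3 → Bool => ∀ r, (∀ y, B r y = false) → Q (Fin.append t r) = Q (Fin.append t zeroVec)
    with hZ'def
  have hZ'mem : ∀ t, t ∈ Z' ↔ ∀ r, (∀ y, B r y = false) → Q (Fin.append t r) = Q (Fin.append t zeroVec) := fun t => by
    rw [hZ'def, mem_filter]; simp only [mem_univ, true_and]
  have hZ'cl : ∀ a ∈ Z', ∀ a' ∈ Z', ∀ a'' ∈ Z', bxor a (bxor a' a'') ∈ Z' := by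
    intro a ha a' ha' a'' ha''
    rw [hZ'mem] at ha ha' ha'' ⊢
    intro r hr
    have e1 := hℓ a (bxor a' a'') r
    have e2 := hℓ a' a'' r
    rw [ha r hr] at e1
    rw [ha' r hr, ha'' r hr] at e2
    rw [e2] at e1
    revert e1
    generalize Q (Fin.append (bxor a (bxor a' a'')) r) = X₁
    generalize Q (Fin.append (bxor a (bxor a' a'')) zeroVec) = X₂
    generalize Q (Fin.append a zeroVec) = X₃
    generalize Q (Fin.append a' zeroVec) = X₄
    generalize Q (Fin.append a'' zeroVec) = X₅
    generalize Q (Fin.append zeroVec r) = X₆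
    generalize Q (Fin.append zeroVec zeroVec) = X₇
    revert X₁ X₂ X₃ X₄ X₅ X₆ X₇
    decide
  -- `Z'` versus the balanced fibres
  have hZB : #Z' + #(univ.filter fun t : Fin 3 → Bool => 2 * w t = 64) = 8 := by
    have e := card_filter_add_card_filter_not (s := (univ : Finset (Fin 3 → Bool)))
      (fun t => ∀ r, (∀ y, B r y = false) → Q (Fin.append t r) = Q (Fin.append t zeroVec))
    have hc : (univ.filter fun t : Fin 3 → Bool => ¬ ∀ r, (∀ y, B r y = false) → Q (Fin.append t r) = Q (Fin.append t zeroVec)) =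
        univ.filter fun t : Fin 3 → Bool => 2 * w t = 64 :=
      filter_congr fun t _ => by rw [hbal t]; push Not; rfl
    rw [hc, card_univ, Fintype.card_fun, Fintype.card_bool, Fintype.card_fin] at e
    change #Z' + _ = 2 ^ 3 at e
    omega
  rcases tfa_affine_closed_card Z' hZ'cl with hZu | hZ4
  · -- every fibre is constant on the radical: type `(1,0)`; the weight is `≥ 160`
    have hall : ∀ t r, (∀ y, B r y = false) → Q (Fin.append t r) = Q (Fin.append t zeroVec) := fun t => by
      have ht : t ∈ Z' := by rw [hZu]; exact mem_univ t
      exact (hZ'mem t).1 ht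
    refine ⟨?_, fun _ t r hr => hall t r hr⟩
    have hnb : ∀ t, w t = 16 ∨ w t = 48 := by
      intro t
      rcases hD t with e | e | e
      · exact Or.inl e
      · exfalso
        obtain ⟨r, hr, hne⟩ := (hbal t).1 (by omega)
        exact hne (hall t r hr)
      · exact Or.inr e
    by_contra hlt
    push Not at hlt
    -- the fibre sum over `u ≠ 111` is `112 + 32 j`
    have hS7 : ∑ v ∈ (univ : Finset (Fin 3 → Bool)).erase allOnes, w v =
        112 + 32 * ∑ v ∈ (univ : Finset (Fin 3 → Bool)).erase allOnes, (if w v = 48 then 1 else 0) := by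
      have hp : ∀ v ∈ (univ : Finset (Fin 3 → Bool)).erase allOnes, w v = 16 + 32 * (if w v = 48 then 1 else 0) := fun v _ => by
        rcases hnb v with e | e <;> simp [e]
      rw [sum_congr rfl hp, sum_add_distrib, sum_const, hcard7, smul_eq_mul, ← mul_sum]
    -- the `9`-bit count of `Q`
    have hQtot : #(univ.filter fun y : Fin (3 + 6) → Bool => Q y = true) =
        (∑ v ∈ (univ : Finset (Fin 3 → Bool)).erase allOnes, w v) + w allOnes := by
      rw [tcc_card_cells Q, ← sum_erase_add _ _ (mem_univ allOnes), hw, sum_congr rfl fun v _ => hw v]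
    have h160 : #(univ.filter fun y : Fin (3 + 6) → Bool => Q y = true) = 160 := by
      have h7 := hnb allOnes
      simp only [Nat.reducePow] at hfib'
      omega
    -- Dickson on `9` bits: `2·160 ∉ {512 − 2⁹⁻ᵏ, 512, 512 + 2⁹⁻ᵏ}`
    have h3' : ∀ u v w' x : Fin (3 + 6) → Bool,
        (((Q x ^^ Q (bxor x w')) ^^ (Q (bxor x v) ^^ Q (bxor (bxor x v) w'))) ^^
          ((Q (bxor x u) ^^ Q (bxor (bxor x u) w')) ^^ (Q (bxor (bxor x u) v) ^^ Q (bxor (bxor (bxor x u) v) w')))) = false := h3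
    obtain ⟨B₉, hB₉⟩ : ∃ B₉ : (Fin (3 + 6) → Bool) → (Fin (3 + 6) → Bool) → Bool,
        ∀ v w', B₉ v w' = ((Q zeroVec ^^ Q w') ^^ (Q v ^^ Q (bxor v w'))) := ⟨_, fun _ _ => rfl⟩
    have hBQ₉ : ∀ v w' x, ((Q x ^^ Q (bxor x w')) ^^ (Q (bxor x v) ^^ Q (bxor (bxor x v) w'))) = B₉ v w' := by
      intro v w' x
      have e := h3' x v w' zeroVec
      simp only [zeroVec_bxor] at e
      rw [hB₉]
      revert e
      cases Q zeroVec <;> cases Q w' <;> cases Q v <;> cases Q (bxor v w') <;> cases Q x <;> cases Q (bxor x w') <;>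
        cases Q (bxor x v) <;> cases Q (bxor (bxor x v) w') <;> decide
    obtain ⟨hs₉, -, ha₉, -⟩ := tcb_form_basic Q B₉ hBQ₉
    obtain ⟨h₉, b₉, c₉, h1, h2, h3b, -, hm⟩ := tcs_frame_exists B₉ hs₉ ha₉
    obtain ⟨hle, hd⟩ := tce_dickson_exact Q B₉ hBQ₉ h₉ b₉ c₉ h1 h2 h3b hm
    rw [h160] at hd
    have hle' : h₉ ≤ 9 := hle
    interval_cases h₉ <;> norm_num at hd
  · -- at most four fibres constant on the radical: at least four balanced fibres, weight `≥ 192`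
    suffices h192 : 192 ≤ #(univ.filter fun y : Fin (3 + 6) → Bool => f y = true) from
      ⟨by omega, fun hlt => absurd hlt (by omega)⟩
    have hpt : ∀ v, 16 + 16 * (if 2 * w v = 64 then 1 else 0) ≤ w v := fun v => by
      split_ifs with hv
      · omega
      · rcases hD v with e | e | e <;> omega
    have hS7 : 112 + 16 * #(((univ : Finset (Fin 3 → Bool)).erase allOnes).filter fun v => 2 * w v = 64) ≤
        ∑ v ∈ (univ : Finset (Fin 3 → Bool)).erase allOnes, w v := by
      have e := sum_le_sum fun v (_ : v ∈ (univ : Finset (Fin 3 → Bool)).erase allOnes) => hpt v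
      rw [sum_add_distrib, sum_const, hcard7, smul_eq_mul, ← mul_sum, ← card_filter] at e
      omega
    have hBE : #(((univ : Finset (Fin 3 → Bool)).erase allOnes).filter fun v => 2 * w v = 64) + (if 2 * w allOnes = 64 then 1 else 0) =
        #(univ.filter fun t : Fin 3 → Bool => 2 * w t = 64) := by
      have hs : ((univ : Finset (Fin 3 → Bool)).erase allOnes).filter (fun v => 2 * w v = 64) =
          (univ.filter fun t : Fin 3 → Bool => 2 * w t = 64).erase allOnes := by
        ext v; simp only [mem_filter, mem_erase, mem_univ, true_and]; tauto
      rw [hs]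
      split_ifs with h7
      · exact card_erase_add_one (mem_filter.2 ⟨mem_univ _, h7⟩)
      · rw [add_zero, erase_eq_of_notMem (s := univ.filter fun t : Fin 3 → Bool => 2 * w t = 64) (a := allOnes)
          fun hm => h7 (mem_filter.1 hm).2]
    have h7 := hD allOnes
    simp only [Nat.reducePow] at hfib'
    split_ifs at hBE with h7b <;> omega

end Summit.QuantumAdvantage.QuantumAdvantage.Theorems.CubicForrelation.NearExactIsExact
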